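import Mathlib
import HarnessLib
import Literature.Computability.AlgebraicComplexity.KRSTDesign
import Literature.Computability.AlgebraicComplexity.ValiantClasses
import Literature.Computability.AlgebraicComplexity.StandardFamilies
import Literature.Barriers.ValiantsHypothesis.CT23LowerBoundsFromSuccinctHittingSets
import Summits.ValiantsHypothesis.ValiantsHypothesis.Theorems.DefinabilityGapAffineRung
import Summits.ValiantsHypothesis.ValiantsHypothesis.Theorems.DefinabilityGapK2cPFamilyRung

/-!
# DefinabilityGap — the INTEGRAL p-family rung of K2c (kernel, unconditional)
# (support for `KIAnnihilatorDefinableOnCollapse`, item `stmt-ValiantsHypothesis-23546`)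

Route `route-ValiantsHypothesis-DefinabilityGap` (decomp-valiant lens 5, gen 2). Sharpening of the p-family rung
`DefinabilityGapK2cPFamilyRung.k2c_pFamily_rung` to the CONSTANT-FREE format in which the definability ladder above it is
written (`VNP⁰` / `VPSPACE⁰_b` are classes of INTEGER families; Chatterjee–Tengse's annihilators are computed by constant-free
projection circuits): the planted KI permanent map `G_m` (integer coefficients) has, for every `m ≥ 1`, a nonzero annihilator
WITH INTEGER COEFFICIENTS, and these form a p-family —
* `map_kiPerK` : base change — the planted map `kiGenerator (perPad K _) (quadDesign m)` over any commutative semiring `K`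
  maps to the one over `K'` (`K = ℂ` gives `kiPer m` definitionally);
* `kiPerK_annihilator_exists` : over any FIELD `K`, a nonzero annihilator of individual degree `≤ q³·m` (CT23 Lemma 3.2, tree);
* `exists_clear_denominators` : an `MvPolynomial σ ℚ` times the product of its denominators is an integer polynomial (support preserved);
* `k2c_integral_rung : ∃ A : ∀ m, MvPolynomial (𝔽_q³-indices) ℤ, IsPFamily A ∧ ∃ m₁, ∀ m ≥ m₁, A m ≠ 0 ∧ (A m read in ℂ) ∘ G_m = 0`.
What separates this rung from K2c is now literally the p-definability of ONE integer coefficient function (a Boolean sum /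
GapP-type description), cf. the kit's K2c ladder `p-family ⊂ integral p-family ⊂ VPSPACE⁰_b (CT23 Thm 3.1) ⊂? VNP (K2c, under VP = VNP)`.
-/

noncomputable section

open MvPolynomial
open Literature.Computability.AlgebraicComplexity Literature.Computability.MetaComplexity
open Summit.ValiantsHypothesis.ValiantsHypothesis.Theorems.DefinabilityGapAffineRung (qOf qOf_spec sq_le_qOf quadDesign kiPer)
open Summit.ValiantsHypothesis.ValiantsHypothesis.Theorems.DefinabilityGapK2cPFamilyRung
  (isPBounded_qOf_pow totalDegree_le_card_mul_of_degreeOf_le)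

namespace Summit.ValiantsHypothesis.ValiantsHypothesis.Theorems.DefinabilityGapK2cIntegralRung

/-! ### The planted map over an arbitrary coefficient semiring, and base change -/

/-- **Base change**: the planted map is defined over the prime ring — `map f (G_m over K) = G_m over K'` for every ring
homomorphism `f` (the permanent has coefficients `1`: tree `map_perPoly`). [cite: Burgisser2000, §2.1] -/
theorem map_kiPerK {K K' : Type*} [CommSemiring K] [CommSemiring K'] (f : K →+* K') (m : ℕ)
    (c : Fin 3 → Fin (qOf m)) :
    map f (kiGenerator (perPad K (sq_le_qOf m)) (quadDesign m) c) =
      kiGenerator (perPad K' (sq_le_qOf m)) (quadDesign m) c := by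
  simp only [kiGenerator_apply, perPad, map_rename, map_perPoly]

/-- **An annihilator of bounded individual degree exists over every field** (CT23 Lemma 3.2 = tree
`exists_annihilator_degreeOf_le_of_two_mul_le` on the planted map: `q³` outputs of degree `≤ m` in `q²` seed variables,
`q³ ≥ 2q²`). [cite: ChatterjeeTengse2023, Lemma 3.2] -/
theorem kiPerK_annihilator_exists (K : Type) [Field K] (m : ℕ) (hm : 1 ≤ m) :
    ∃ A : MvPolynomial (Fin 3 → Fin (qOf m)) K, A ≠ 0 ∧ (∀ j, A.degreeOf j ≤ qOf m ^ 3 * m) ∧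
      bind₁ (kiGenerator (perPad K (sq_le_qOf m)) (quadDesign m)) A = 0 := by
  classical
  have hq2 : 2 ≤ qOf m := (qOf_spec m).2.two_le
  let eo : (Fin 3 → Fin (qOf m)) ≃ Fin (qOf m ^ 3) := finFunctionFinEquiv
  let ei : Fin (qOf m) × Fin (qOf m) ≃ Fin (qOf m * qOf m) := finProdFinEquiv
  let G' : Fin (qOf m ^ 3) → MvPolynomial (Fin (qOf m * qOf m)) K :=
    fun i => rename ei (kiGenerator (perPad K (sq_le_qOf m)) (quadDesign m) (eo.symm i))
  have hdeg : ∀ i, (G' i).totalDegree ≤ m := by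
    intro i
    refine (totalDegree_rename_le _ _).trans ?_
    rw [kiGenerator_apply]
    exact (totalDegree_rename_le _ _).trans (totalDegree_perPad_le (sq_le_qOf m))
  have hin : 1 ≤ qOf m * qOf m := Nat.one_le_iff_ne_zero.2 (Nat.mul_ne_zero (by omega) (by omega))
  have hn : 2 * (qOf m * qOf m) ≤ qOf m ^ 3 := by
    calc 2 * (qOf m * qOf m) ≤ qOf m * (qOf m * qOf m) := Nat.mul_le_mul_right _ hq2
      _ = qOf m ^ 3 := by ring
  obtain ⟨A', hA'0, hA'deg, hA'⟩ :=
    Literature.Barriers.ValiantsHypothesis.exists_annihilator_degreeOf_le_of_two_mul_le (K := K) hin hm hn G' hdeg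
  refine ⟨rename eo.symm A', ?_, fun j => ?_, ?_⟩
  · intro h
    exact hA'0 (rename_injective _ eo.symm.injective (by rw [h, map_zero]))
  · have := hA'deg (eo j)
    rw [← degreeOf_rename_of_injective eo.symm.injective (eo j), Equiv.symm_apply_apply] at this
    exact this.trans (by nlinarith [hdeg (eo j)])
  · have h1 : bind₁ (kiGenerator (perPad K (sq_le_qOf m)) (quadDesign m)) (rename eo.symm A') =
        bind₁ (fun i => kiGenerator (perPad K (sq_le_qOf m)) (quadDesign m) (eo.symm i)) A' :=
      bind₁_rename _ _ _
    have h2 : rename ei (bind₁ (fun i => kiGenerator (perPad K (sq_le_qOf m)) (quadDesign m) (eo.symm i)) A') =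
        aeval G' A' := by
      rw [rename_bind₁]; rfl
    rw [h1]
    exact rename_injective _ ei.injective (by rw [h2, hA', map_zero])

/-! ### Clearing denominators -/

/-- **Clearing denominators**: for `A ∈ ℚ[σ]`, with `N` the product of the denominators of its coefficients, `N·A` is (the
image of) an integer polynomial `B` with the same support. [folklore] -/
theorem exists_clear_denominators {σ : Type*} (A : MvPolynomial σ ℚ) :
    ∃ (N : ℕ) (B : MvPolynomial σ ℤ), N ≠ 0 ∧ map (Int.castRingHom ℚ) B = C (N : ℚ) * A ∧
      B.support ⊆ A.support := by
  classical
  set N : ℕ := ∏ t ∈ A.support, (A.coeff t).den with hN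
  have hNne : N ≠ 0 := Finset.prod_ne_zero_iff.2 fun t _ => (A.coeff t).den_nz
  have hdvd : ∀ s ∈ A.support, (A.coeff s).den ∣ N := fun s hs => Finset.dvd_prod_of_mem _ hs
  let z : (σ →₀ ℕ) → ℤ := fun s => (A.coeff s).num * ((N / (A.coeff s).den : ℕ) : ℤ)
  refine ⟨N, ∑ s ∈ A.support, monomial s (z s), hNne, ?_, ?_⟩
  · ext s
    simp only [coeff_map, coeff_sum, coeff_monomial, Finset.sum_ite_eq', coeff_C_mul]
    by_cases hs : s ∈ A.support
    · rw [if_pos hs]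
      set c := A.coeff s with hc
      have hcd : (c.den : ℚ) ≠ 0 := Nat.cast_ne_zero.2 c.den_nz
      have hdiv : ((N / c.den : ℕ) : ℚ) = (N : ℚ) / c.den := Nat.cast_div (hdvd s hs) hcd
      have hnum : (c.num : ℚ) / c.den = c := Rat.num_div_den c
      simp only [z, eq_intCast, Int.cast_mul, Int.cast_natCast]
      rw [hdiv]
      calc (c.num : ℚ) * ((N : ℚ) / c.den) = (N : ℚ) * ((c.num : ℚ) / c.den) := by ring
        _ = (N : ℚ) * c := by rw [hnum]
    · rw [if_neg hs, notMem_support_iff.1 hs, mul_zero, map_zero]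
  · intro s hs
    rw [mem_support_iff] at hs
    by_contra hs'
    apply hs
    simp only [coeff_sum, coeff_monomial, Finset.sum_ite_eq', if_neg hs']

/-- Support inclusion bounds the total degree. [folklore] -/
theorem totalDegree_le_of_support_subset {R S : Type*} [CommSemiring R] [CommSemiring S] {σ : Type*}
    {B : MvPolynomial σ R} {A : MvPolynomial σ S} (h : B.support ⊆ A.support) :
    B.totalDegree ≤ A.totalDegree :=
  Finset.sup_mono h

/-! ### The integral annihilator and the integral p-family rung -/

/-- **An INTEGER annihilator of the planted map exists** for every `m ≥ 1`: nonzero, individual degrees `≤ q³·m`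
(hence total degree `≤ q⁶·m`), annihilating `G_m` when read in `ℂ`. [cite: ChatterjeeTengse2023, Lemma 3.2] -/
theorem kiPer_integral_annihilator_exists (m : ℕ) (hm : 1 ≤ m) :
    ∃ B : MvPolynomial (Fin 3 → Fin (qOf m)) ℤ, B ≠ 0 ∧
      B.totalDegree ≤ Fintype.card (Fin 3 → Fin (qOf m)) * (qOf m ^ 3 * m) ∧
      bind₁ (kiPer m) (map (Int.castRingHom ℂ) B) = 0 := by
  classical
  obtain ⟨A, hA0, hAdeg, hAann⟩ := kiPerK_annihilator_exists ℚ m hm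
  obtain ⟨N, B, hN, hBA, hsupp⟩ := exists_clear_denominators A
  refine ⟨B, ?_, ?_, ?_⟩
  · intro hB
    have h1 : C (N : ℚ) * A ≠ 0 :=
      mul_ne_zero (by rw [Ne, C_eq_zero]; exact Nat.cast_ne_zero.2 hN) hA0
    exact h1 (by rw [← hBA, hB, map_zero])
  · exact (totalDegree_le_of_support_subset hsupp).trans (totalDegree_le_card_mul_of_degreeOf_le hAdeg)
  · have hf : Int.castRingHom ℂ = (algebraMap ℚ ℂ).comp (Int.castRingHom ℚ) := RingHom.ext_int _ _
    have hG : (fun c => map (algebraMap ℚ ℂ) (kiGenerator (perPad ℚ (sq_le_qOf m)) (quadDesign m) c)) = kiPer m := by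
      funext c
      rw [map_kiPerK]
      rfl
    have hmapann : bind₁ (kiPer m) (map (algebraMap ℚ ℂ) A) = 0 := by
      rw [← hG, ← map_bind₁, hAann, map_zero]
    rw [hf, ← map_map, hBA, map_mul, map_C, map_mul, bind₁_C_right, hmapann, mul_zero]

/-- **The integral p-family rung of K2c** (KERNEL, unconditional): a family `(A_m)` of INTEGER polynomials which is a
p-family (`q(m)³` variables, total degree `≤ q(m)⁶·m`) and, for every `m ≥ 1`, a nonzero annihilator of the planted map
`G_m` read in `ℂ` — K2c's conclusion with `IsVNPFamily` truncated to `IsPFamily` AND the coefficients forced into `ℤ`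
(the format of `VNP⁰` / `VPSPACE⁰_b`), no collapse hypothesis.
[cite: ChatterjeeTengse2023, Lemma 3.2, Thm 3.1 (the next rung: constant-free projection circuits)] -/
theorem k2c_integral_rung :
    ∃ A : ∀ m : ℕ, MvPolynomial (Fin 3 → Fin (qOf m)) ℤ,
      IsPFamily A ∧ ∃ m₁, ∀ m, m₁ ≤ m → A m ≠ 0 ∧ bind₁ (kiPer m) (map (Int.castRingHom ℂ) (A m)) = 0 := by
  classical
  have hex : ∀ m : ℕ, ∃ B : MvPolynomial (Fin 3 → Fin (qOf m)) ℤ,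
      B.totalDegree ≤ Fintype.card (Fin 3 → Fin (qOf m)) * (qOf m ^ 3 * m) ∧
        (1 ≤ m → B ≠ 0 ∧ bind₁ (kiPer m) (map (Int.castRingHom ℂ) B) = 0) := by
    intro m
    by_cases hm : 1 ≤ m
    · obtain ⟨B, hB0, hdeg, hann⟩ := kiPer_integral_annihilator_exists m hm
      exact ⟨B, hdeg, fun _ => ⟨hB0, hann⟩⟩
    · exact ⟨0, by rw [totalDegree_zero]; exact Nat.zero_le _, fun h => absurd h hm⟩
  choose A hAdeg hA using hex
  refine ⟨A, ⟨?_, ?_⟩, 1, fun m hm => hA m hm⟩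
  · refine IsPBounded.mono (t := fun m => qOf m ^ 3) (isPBounded_qOf_pow 3) fun m => ?_
    simp [Fintype.card_fin]
  · refine IsPBounded.mono (t := fun m => qOf m ^ 3 * (qOf m ^ 3 * m))
      (IsPBounded.mul_holds (isPBounded_qOf_pow 3)
        (IsPBounded.mul_holds (isPBounded_qOf_pow 3) IsPBounded.id)) fun m => ?_
    refine (hAdeg m).trans (le_of_eq ?_)
    simp [Fintype.card_fin]

/-- The integral rung implies the p-family rung over `ℂ` (read the integer family in `ℂ`; degrees do not grow under `map`).
[this file] -/
theorem pFamily_of_integral {A : ∀ m : ℕ, MvPolynomial (Fin 3 → Fin (qOf m)) ℤ}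
    (h : IsPFamily A ∧ ∃ m₁, ∀ m, m₁ ≤ m → A m ≠ 0 ∧ bind₁ (kiPer m) (map (Int.castRingHom ℂ) (A m)) = 0) :
    IsPFamily (fun m => map (Int.castRingHom ℂ) (A m)) ∧
      ∃ m₁, ∀ m, m₁ ≤ m → map (Int.castRingHom ℂ) (A m) ≠ 0 ∧
        bind₁ (kiPer m) (map (Int.castRingHom ℂ) (A m)) = 0 := by
  obtain ⟨⟨hv, hd⟩, m₁, hA⟩ := h
  refine ⟨⟨hv, hd.mono fun m => ?_⟩, m₁, fun m hm => ⟨?_, (hA m hm).2⟩⟩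
  · exact totalDegree_le_of_support_subset (support_map_subset _ _)
  · intro h0
    exact (hA m hm).1 (map_injective _ (RingHom.injective_int (Int.castRingHom ℂ)) (by rw [h0, map_zero]))

end Summit.ValiantsHypothesis.ValiantsHypothesis.Theorems.DefinabilityGapK2cIntegralRung

end
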